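import Summits.QuantumFields.BalabanUV.T4Continuum.Support.VariationalCovariantEnd
import Summits.QuantumFields.BalabanUV.T4Continuum.Support.VariationalCovariantScalarPairClosedRel

/-!
# T⁴ programme, spine node NE2 (U1a), lane P2 — THE END WITH UB⁺ RELATIVE TO A REFERENCE TRANSPORT (repair R3 of the located finding
# N-ne2p2g11-2): the η-rate `TowerLimitRate (fun _ ↦ 1) 1 (k ↦ effSc (L^k) M (Rc k) (T k) a₀) (cEnd d L c_w′ c_a c_m c₁) L⁻¹` for NESTED
# constraint transports `T k` (COMP⁺ as before), the upper bound supplied from REFERENCE transports `T₀ k` with thin in-block defect and a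
# k-uniform relative-phase bound `γ < 1` (road owner `b2b-balaban-t4-ne2-p2` gen 11; `t4/skeletons/NE2-t4-ne2-p2.md` v0.11 §2.D-bis)

WHY.  `VariationalCovariantEnd.towerLimitRate_scalarTower_closed` (p213959) is correct but asks the SAME `T k` to be nested (COMP⁺, so that ONE⁺'s
one-step defects are `O(α n⁻²)`) and to have in-block defect `w_k` with `n·w_k ≤ c_w` (leaf-04's UB⁺); nested composites have `w = Θ(α)`
(numerics `HOME/b2b-balaban-t4-ne2-p2-g11/wnest.py`: `n·w` grows linearly), so its binders hold together only near flat data.  Here UB⁺ comes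
from `VariationalCovariantScalarPairClosedRel.scalar_pair_closed_rel` (R2, on `VariationalCovariantUpperBoundRel.exists_ub_scalarPair_rel_eff`, R1):
the straight reference `T₀ k` carries the thin defect (`n·w_k ≤ c_w`, leaf-04-g2's `inBlock_defect_taxiT_le` for taxi data), the nested `T k` only
the relative phase `‖T k x·conj (T₀ k x) − 1‖ ≤ γ` (k-uniform small field; for nested-vs-straight taxi a holonomy of `O(d²L²·n²a)` plaquette
units summed geometrically over levels — geometric leaf (O10), not proved here), and the END's CLASS is read on the fictitious defect
`w′_k` with `(4 + n w_k)/(1−γ) − 1 ≤ n·w′_k ≤ c_w′`.  Everything else — ONE⁺, REG⁺, FED⁺, P⁺, COMP⁺, the rate lemmas, `cEnd` — is p213959's,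
BY NAME (`towerLimitRate_of_closedBrackets` applied verbatim with `w := w′`).

HONEST FRAMING (T4-DAG p. 1).  Rung (B)+1 only — NOT infinite volume, NOT a mass gap, NOT Clay.  NE2 is NOT IN PRINT and NOT proved here.
MODEL LEVEL (phases, transports, frames, defects = DATA; U(1) charged scalar = King's (2.14) species WITH background; global small field);
single nested tower (one background and its straight coarsenings — the canonical tower); the TWO-RUNS face is NOT this theorem (for nested
transport systems the aligned-connection distance of leaf L-LIP concentrates on coarse sub-faces — skeleton §2.D-bis (iii), open).  Plumbing,
[folklore]; nothing printed is a hypothesis; no `def`; no `def … : Prop`; no `sorry`; axioms standard.  HONEST DEPENDENCY (cell, verbatim):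
continuum YM on T⁴ ⇐ BetaPertH ∧ nine spine estimates (0/9 proved); BetaPertH ⇐ (D1) ∧ (D4) ∧ CAP+tail; G-an2-4 gates asym, D1 and NE2/3/4.
-/

noncomputable section

open scoped Matrix ComplexConjugate ComplexOrder Matrix.Norms.L2Operator BigOperators

namespace Summit.QuantumFields.BalabanUV.T4Continuum.VariationalCovariantEndRel

open Summit.QuantumFields.BalabanUV.T4Continuum.VariationalTransfer (blockSpin)
open Summit.QuantumFields.BalabanUV.T4Continuum.VariationalCovariantEffective (effSc)
open Summit.QuantumFields.BalabanUV.T4Continuum.VariationalCovariantTower (compT Rtr)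
open Summit.QuantumFields.BalabanUV.T4Continuum.VariationalCovariantTowerLaw (eFED eONE eUB)
open Summit.QuantumFields.BalabanUV.T4Continuum.VariationalCovariantEnd
  (lamC cR lamF delta eps1 deltaP lamLevel eLevel ePLevel cEnd towerLimitRate_of_closedBrackets)
open Summit.QuantumFields.BalabanUV.T4Continuum.VariationalCovariantScalarPairClosedRel (scalar_pair_closed_rel)
open Summit.QuantumFields.BalabanUV.T4Continuum.CovariantAveragingTower (TowerLimitRate)
open Summit.QuantumFields.BalabanUV.T4Continuum.VariationalCovariantFederbush (mis)
open Literature.MathematicalPhysics.QuantumFieldTheory.Balaban1983to89.B5Prop11Lower (nsq nsq_nonneg)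
open Literature.MathematicalPhysics.QuantumFieldTheory.Balaban1983to89.B5Prop11Plancherel (Tor fine unitVec)
open Literature.MathematicalPhysics.QuantumFieldTheory.Balaban1983to89.B5Block118 (bpt)
open Summit.QuantumFields.BalabanUV.T4Continuum.VariationalCovariantScalarPair (Sc Sf qW Qk Q1 qW_le_coarse)

variable {d : ℕ} (L : ℕ) [NeZero L] (M : Fin d → ℕ) [hM : ∀ μ, NeZero (M μ)]
variable (Rc : (k : ℕ) → Tor (fine (L ^ k) M) → Fin d → ℂ) (T T₀ : (k : ℕ) → Tor (fine (L ^ k) M) → ℂ)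
variable (R' : (k : ℕ) → Tor (fine L (fine (L ^ k) M)) → Fin d → ℂ) (T' : (k : ℕ) → Tor (fine L (fine (L ^ k) M)) → ℂ)
variable (G : (k : ℕ) → Tor (fine (L ^ k) M) → ℂ) (c : (k : ℕ) → Tor M → ℂ) (mG mB : ℕ → ℝ)
variable (G' : (k : ℕ) → Tor (fine L (fine (L ^ k) M)) → ℂ) (c' : (k : ℕ) → Tor (fine (L ^ k) M) → ℂ) (mG' mB' : ℕ → ℝ)
variable (m w w' a m₁ : ℕ → ℝ)

/-- **THE END WITH UB⁺ RELATIVE TO A REFERENCE TRANSPORT (P2, scalar covariant species, nested canonical tower, model level).**  As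
`VariationalCovariantEnd.towerLimitRate_scalarTower_closed` (p213959) except the UB⁺ data: the in-block defect `w_k` is that of the REFERENCE
transports `T₀ k` (unit modulus) relative to `Rc k`, the constraint transports `T k` (unit modulus, COMP⁺-nested) are tied to them only by the
relative phase `‖T k x·conj (T₀ k x) − 1‖ ≤ γ < 1`, and the CLASS bound is read on `w′_k` with `(4 + n w_k)/(1−γ) − 1 ≤ n·w′_k ≤ c_w′`.
THEN `TowerLimitRate (fun _ ↦ 1) 1 (fun k => effSc (L^k) M (Rc k) (T k) a₀) (cEnd d L c_w′ c_a c_m c₁) L⁻¹`.  NO leaf binder, NO NE3;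
NE2 NOT proved. [folklore] -/
theorem towerLimitRate_scalarTower_closed_rel (hL : 2 ≤ L)
    -- tower data and COMP⁺
    (hT : ∀ k x, ‖T k x‖ = 1) (hRc1 : ∀ k y μ, ‖Rc k y μ‖ = 1) (hR' : ∀ k x μ, ‖R' k x μ‖ ≤ 1) (hT'1 : ∀ k x, ‖T' k x‖ = 1)
    (hTcomp : ∀ k, T (k + 1) = compT (L ^ k) L M (T k) (T' k)) (hRtr : ∀ k, Rc (k + 1) = Rtr (L ^ k) L M (R' k))
    -- P⁺ data (global frames) at every level and one step up
    (hG : ∀ k x, ‖G k x‖ = 1) (hc : ∀ k z, ‖c k z‖ ≤ 1)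
    (hframe : ∀ k x μ, ‖G k (x + unitVec (fine (L ^ k) M) μ) - G k x * Rc k x μ‖ ≤ mG k)
    (hblock : ∀ k z j, ‖G k (bpt (L ^ k) M z j) - c k z * T k (bpt (L ^ k) M z j)‖ ≤ mB k)
    (hsmall : ∀ k, 16 * (d : ℝ) ^ 2 * ((((L ^ k : ℕ)) : ℝ) * mG k) ^ 2 + 4 * mB k ^ 2 ≤ 1 / 2)
    (hG' : ∀ k x, ‖G' k x‖ = 1) (hc' : ∀ k y, ‖c' k y‖ ≤ 1)
    (hframe' : ∀ k x μ, ‖G' k (x + unitVec (fine L (fine (L ^ k) M)) μ) - G' k x * R' k x μ‖ ≤ mG' k)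
    (hblock' : ∀ k y j, ‖G' k (bpt L (fine (L ^ k) M) y j) - c' k y * T' k (bpt L (fine (L ^ k) M) y j)‖ ≤ mB' k)
    (hsmall' : ∀ k, 16 * (d : ℝ) ^ 2 * ((L : ℝ) * mG' k) ^ 2 + 4 * mB' k ^ 2 ≤ 1 / 2)
    -- FED⁺ data: one-block mismatch, absorbed
    (hm : ∀ k, 0 ≤ m k) (hmis : ∀ k y μ j, ‖mis L (fine (L ^ k) M) (Rc k) (R' k) (T' k) y μ j‖ ≤ m k)
    (habsorb : ∀ k, 512 * (d : ℝ) ^ 2 * ((((L ^ k : ℕ)) : ℝ) * m k) ^ 2 ≤ 1 / 2)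
    -- UB⁺ data RELATIVE: reference transports `T₀ k`, their in-block defect `w k`, relative phase `γ`, fictitious defect `w′ k`
    (hT₀ : ∀ k x, ‖T₀ k x‖ = 1) (hw : ∀ k, 0 ≤ w k)
    (hwin : ∀ k (y : Tor M) (j : Fin d → Fin (L ^ k)) (μ : Fin d), (j μ : ℕ) + 1 < L ^ k →
      ‖Rc k (bpt (L ^ k) M y j) μ * (starRingEnd ℂ) (T₀ k (bpt (L ^ k) M y j + unitVec (fine (L ^ k) M) μ)) * T₀ k (bpt (L ^ k) M y j) - 1‖
        ≤ w k)
    {γ : ℝ} (hγ : γ < 1) (hrel : ∀ k x, ‖T k x * (starRingEnd ℂ) (T₀ k x) - 1‖ ≤ γ)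
    (hw'0 : ∀ k, 0 ≤ w' k) (hw' : ∀ k, (4 + (((L ^ k : ℕ)) : ℝ) * w k) / (1 - γ) - 1 ≤ (((L ^ k : ℕ)) : ℝ) * w' k)
    -- REG⁺ data: plaquette defect
    (ha : ∀ k, 0 ≤ a k)
    (hP : ∀ k x μ ν, ‖Rc k x μ * Rc k (x + unitVec (fine (L ^ k) M) μ) ν - Rc k x ν * Rc k (x + unitVec (fine (L ^ k) M) ν) μ‖ ≤ a k)
    -- ONE⁺ data: one-step in-block / face-crossing defects
    (hm₁ : ∀ k, 0 ≤ m₁ k)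
    (hin : ∀ k (y : Tor (fine (L ^ k) M)) (j : Fin d → Fin L) (μ : Fin d), (j μ : ℕ) + 1 < L →
      ‖R' k (bpt L (fine (L ^ k) M) y j) μ * (starRingEnd ℂ) (T' k (bpt L (fine (L ^ k) M) y j + unitVec (fine L (fine (L ^ k) M)) μ))
          * T' k (bpt L (fine (L ^ k) M) y j) - 1‖ ≤ m₁ k)
    (hcross : ∀ k (y : Tor (fine (L ^ k) M)) (j : Fin d → Fin L) (μ : Fin d), (j μ : ℕ) + 1 = L →
      ‖R' k (bpt L (fine (L ^ k) M) y j) μ * (starRingEnd ℂ) (T' k (bpt L (fine (L ^ k) M) y j + unitVec (fine L (fine (L ^ k) M)) μ))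
          * T' k (bpt L (fine (L ^ k) M) y j) - Rc k y μ‖ ≤ m₁ k)
    -- CLASS (read on w′)
    {cw ca cm c₁ : ℝ}
    (hwc : ∀ k, (((L ^ k : ℕ)) : ℝ) * w' k ≤ cw) (hac : ∀ k, a k * (((L ^ k : ℕ)) : ℝ) ^ 2 ≤ ca)
    (hmc : ∀ k, (((L ^ k : ℕ)) : ℝ) ^ 2 * m k ≤ cm) (hm₁c : ∀ k, (((L ^ k : ℕ)) : ℝ) ^ 2 * m₁ k ≤ c₁)
    {a₀ : ℝ} (ha₀ : 0 < a₀) :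
    TowerLimitRate (ι := fun _ => Tor M) (fun _ => (1 : Matrix (Tor M) (Tor M) ℂ)) 1
      (fun k => effSc (L ^ k) M (Rc k) (T k) a₀) (cEnd d L cw ca cm c₁) ((L : ℝ)⁻¹) := by
  refine towerLimitRate_of_closedBrackets L M Rc T R' T' hL hT (CP' := fun _ => 1088 * (d : ℝ) + 128)
    (fun k f => qW_le_coarse (L ^ k) M (hG k) (hc k) (hframe k) (hblock k) (hsmall k) f) hTcomp hRtr ha₀ w' a m m₁
    hw'0 hwc ha hac hm hmc hm₁ hm₁c fun k μ => ?_
  have h := scalar_pair_closed_rel (L ^ k) L M (hG k) (hc k) (hframe k) (hblock k) (hsmall k) (hG' k) (hc' k) (hframe' k) (hblock' k)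
    (hsmall' k) (hR' k) (hT'1 k) (hm k) (hmis k) (habsorb k) (hT k) (hRc1 k) (hT₀ k) (hw k) (hwin k) hγ (hrel k) (hw'0 k) (hw' k)
    (ha k) (hP k) (hm₁ k) (hin k) (hcross k) μ
  simp only [eLevel, ePLevel, lamLevel, lamF, lamC, cR, eFED, eONE, eUB, delta, eps1, deltaP]
  simpa only using h

end Summit.QuantumFields.BalabanUV.T4Continuum.VariationalCovariantEndRel

end
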